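import Summits.ResolutionOfSingularities.ResolutionOfSingularities.Theorems.WeightedInvariantStratumIffOfStrat
import Summits.ResolutionOfSingularities.ResolutionOfSingularities.Theorems.WeightedInvariantOrderHasseZariskiNagata
import Mathlib.RingTheory.RegularLocalRing.Polynomial
import HarnessLib

/-!
# Stratum-exactness of (open″) on models: the `V(U)`-form of the iff, and the order function on affine space
# — door `HypersurfaceCentreConstruction` (stmt-ResolutionOfSingularities-19897), route `WeightedInvariant`

[OURS · L1 W4.3 · cell `res-hironaka`, HUMAN RULING D-0089] Helper file `--supports stmt-ResolutionOfSingularities-19897`;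
after-care of `Theorems/WeightedInvariantStratumIffOfStrat.lean` (p511396, tri-2 (D7) readback made kernel). Typer
res-type-073 (gen 10). AI-produced, weaker than expert review. NOT a statement of the manuscript under review (Hironaka
2017, [claim: Hironaka2017, status: under-review]); nothing here is attributed to its author; nothing here is a claim about
resolution of singularities. `J`-free; no definitions.

## Contents

* `comap_map_le_iff_of_not_mem` / `exists_forall_le_iff_comap_le` — the `V(U)`-FORM BRIDGE: for a Noetherian `A`, a prime
  `𝔪` and an ideal `I₀ ⊆ A` (think `I₀ = (U_i : w_i > 0)`, the positively weighted members of the presenting system,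
  which by (pres) generate the centre `P = I₀ A_𝔪`), there is `h ∉ 𝔪` with `I₀ ⊆ 𝔮 ↔ (I₀ A_𝔪) ∩ A ⊆ 𝔮` for every prime
  `𝔮 ∌ h` (kill the denominators of finitely many generators of the contraction).
* `stratumIff_forall_mem_of_comap` — hence the conclusion of `StratumIff.stratumIff_iota_of_strat` (centre read as
  `V(P ∩ A)`) becomes the LITERAL stratum iff of `JOpenPresentationForallSing`: `(∀ i, U i ∈ 𝔮) ↔ (F ∈ 𝔪_{A_𝔮}² ∧ ι =)`
  on a smaller basic open, for any `U : Fin N → A` whose positively weighted members generate `P` in `A_𝔪`.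
* `husc_iotaOrd_mvPolynomial` — the remaining input of `StratumIff.stratumIff_iotaOrd_of_strat` DISCHARGED on AFFINE
  SPACE over a perfect field: `{𝔮 : n ≤ ord_𝔮 f} = V(D^{(β)} f : |β| < n)` (res-type-078's
  `algebraMap_mem_maximalIdeal_pow_iff_forall_hasseDeriv_mem`, p502410 — Hasse–Schmidt derivatives, EGA IV 16.11).
* `stratumIff_iotaOrd_mvPolynomial` — so on the model `A = K[x_σ]` (`K` perfect; every prime `𝔪`, closed or not) the
  stratum-exactness iff for `ι = iotaOrd` follows from the (strat)+(adm) conjuncts of the game clause at `A_𝔪` ALONE.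

## References

* A. Grothendieck, EGA IV₄, Thm. 16.11.2 (Taylor / Hasse–Schmidt), via res-type-078's tree file
  `WeightedInvariantOrderHasseZariskiNagata.lean`. [EGAIV4]
* V. Cossart, O. Piltant, J. Algebra 320 (2008), proof of Prop. 4.2 (upper semicontinuity of the order). [CossartPiltant2008]
-/

noncomputable section

set_option linter.dupNamespace false -- mandated namespace `Summit.<Summit>.<Problem>` of this single-conjunct summit

open IsLocalRing Literature.AlgebraicGeometry.Resolution
open Summit.ResolutionOfSingularities.ResolutionOfSingularities.Theorems

namespace Summit.ResolutionOfSingularities.ResolutionOfSingularities.Cruxes.HypersurfaceCentreConstruction.LocalEngine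

namespace StratumIff

variable {A : Type} [CommRing A]

/-! ## §1. The `V(U)`-form bridge: `V(I₀) = V((I₀ A_𝔪) ∩ A)` near `𝔪` -/

/-- Membership in the contraction `(I₀ A_𝔪) ∩ A`: `a ∈ (I₀ A_𝔪) ∩ A ↔ s·a ∈ I₀` for some `s ∉ 𝔪`. [folklore] -/
theorem mem_comap_map_iff (𝔪 : Ideal A) [𝔪.IsPrime] (I₀ : Ideal A) (a : A) :
    a ∈ (I₀.map (algebraMap A (Localization.AtPrime 𝔪))).comap (algebraMap A (Localization.AtPrime 𝔪)) ↔
      ∃ s ∉ 𝔪, s * a ∈ I₀ := by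
  rw [Ideal.mem_comap, IsLocalization.algebraMap_mem_map_algebraMap_iff 𝔪.primeCompl]
  exact ⟨fun ⟨s, hs, h⟩ => ⟨s, hs, h⟩, fun ⟨s, hs, h⟩ => ⟨s, hs, h⟩⟩

/-- **The bridge** (`A` Noetherian): there is `h ∉ 𝔪` such that for every prime `𝔮 ∌ h`,
`I₀ ⊆ 𝔮 ↔ (I₀ A_𝔪) ∩ A ⊆ 𝔮`. Proof: the contraction is generated by finitely many `a_j` with `s_j a_j ∈ I₀`,
`s_j ∉ 𝔪`; take `h = ∏ s_j`. [folklore] -/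
theorem exists_forall_le_iff_comap_le [IsNoetherianRing A] (𝔪 : Ideal A) [𝔪.IsPrime] (I₀ : Ideal A) :
    ∃ h : A, h ∉ 𝔪 ∧ ∀ (𝔮 : Ideal A) [𝔮.IsPrime], h ∉ 𝔮 →
      (I₀ ≤ 𝔮 ↔ (I₀.map (algebraMap A (Localization.AtPrime 𝔪))).comap (algebraMap A (Localization.AtPrime 𝔪)) ≤ 𝔮) := by
  classical
  set C : Ideal A := (I₀.map (algebraMap A (Localization.AtPrime 𝔪))).comap (algebraMap A (Localization.AtPrime 𝔪))
    with hC
  obtain ⟨T, hT⟩ := (inferInstance : IsNoetherianRing A).noetherian C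
  have hgen : ∀ a ∈ T, ∃ s : A, s ∉ 𝔪 ∧ s * a ∈ I₀ := by
    intro a ha
    have haC : a ∈ C := hT ▸ Ideal.subset_span ha
    obtain ⟨s, hs, hsa⟩ := (mem_comap_map_iff 𝔪 I₀ a).mp haC
    exact ⟨s, hs, hsa⟩
  choose! s hs using hgen
  refine ⟨∏ a ∈ T, s a, ?_, fun 𝔮 _ h𝔮 => ⟨fun hI₀ => ?_, fun hC𝔮 => ?_⟩⟩
  · rw [Ideal.IsPrime.prod_mem_iff]
    rintro ⟨a, ha, hsa⟩
    exact (hs a ha).1 hsa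
  · -- generators of `C` lie in `𝔮`
    rw [← hT, Ideal.span_le]
    intro a ha
    have hsa𝔮 : s a ∉ 𝔮 := fun h => h𝔮 (by
      obtain ⟨c, hc⟩ := Finset.dvd_prod_of_mem s ha
      rw [hc]
      exact Ideal.mul_mem_right _ _ h)
    exact (Ideal.IsPrime.mem_or_mem ‹_› (hI₀ (hs a ha).2)).resolve_left hsa𝔮
  · exact le_trans Ideal.le_comap_map hC𝔮

/-- **The `V(U)`-form of the stratum iff.** Let `U : Fin N → A`, `W : Fin N → ℕ`, and suppose the positively weighted
members generate the centre `P` of `A_𝔪`: `(span {U i | 0 < W i})·A_𝔪 = P` (what (pres) of `CanonicalGameClause`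
provides once `U` is chosen inside `A`). If on some `D(h₁) ∋ 𝔪` the iff `P ∩ A ⊆ 𝔮 ↔ C 𝔮` holds (e.g. the conclusion
of `stratumIff_iota_of_strat`, `C 𝔮 = (F ∈ 𝔪_{A_𝔮}² ∧ ι(A_𝔮) F = ι(A_𝔪) F)`), then on a smaller `D(h) ∋ 𝔪`:
`(∀ i, 0 < W i → U i ∈ 𝔮) ↔ C 𝔮` — and if ALL weights are positive, `(∀ i, U i ∈ 𝔮) ↔ C 𝔮`.
[OURS · L1 W4.3, kernel] -/
theorem stratumIff_forall_mem_of_comap [IsNoetherianRing A] (𝔪 : Ideal A) [𝔪.IsPrime] {N : ℕ}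
    (U : Fin N → A) (W : Fin N → ℕ) (P : Ideal (Localization.AtPrime 𝔪))
    (hU : (Ideal.span {x | ∃ i, 0 < W i ∧ x = U i}).map (algebraMap A (Localization.AtPrime 𝔪)) = P)
    (C : PrimeSpectrum A → Prop)
    (hiff : ∃ h₁ : A, h₁ ∉ 𝔪 ∧ ∀ (𝔮 : Ideal A) [𝔮.IsPrime], h₁ ∉ 𝔮 →
      (P.comap (algebraMap A (Localization.AtPrime 𝔪)) ≤ 𝔮 ↔ C ⟨𝔮, ‹_›⟩)) :
    ∃ h : A, h ∉ 𝔪 ∧ ∀ (𝔮 : Ideal A) [𝔮.IsPrime], h ∉ 𝔮 →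
      ((∀ i, 0 < W i → U i ∈ 𝔮) ↔ C ⟨𝔮, ‹_›⟩) := by
  obtain ⟨h₁, hh₁, hiff⟩ := hiff
  obtain ⟨h₂, hh₂, hbridge⟩ := exists_forall_le_iff_comap_le 𝔪 (Ideal.span {x | ∃ i, 0 < W i ∧ x = U i})
  refine ⟨h₁ * h₂, fun h => (Ideal.IsPrime.mem_or_mem ‹_› h).elim hh₁ hh₂, fun 𝔮 _ h𝔮 => ?_⟩
  have hh₁𝔮 : h₁ ∉ 𝔮 := fun h => h𝔮 (Ideal.mul_mem_right _ _ h)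
  have hh₂𝔮 : h₂ ∉ 𝔮 := fun h => h𝔮 (Ideal.mul_mem_left _ _ h)
  rw [← hiff 𝔮 hh₁𝔮, ← hU, ← hbridge 𝔮 hh₂𝔮, Ideal.span_le]
  constructor
  · rintro hmem x ⟨i, hi, rfl⟩
    exact hmem i hi
  · intro hsub i hi
    exact hsub ⟨i, hi, rfl⟩

/-- All weights positive: the literal `(∀ i, U i ∈ 𝔮) ↔ C 𝔮` form of (open″)'s stratum iff. [OURS · L1 W4.3, kernel] -/
theorem stratumIff_forall_mem_of_comap_of_pos [IsNoetherianRing A] (𝔪 : Ideal A) [𝔪.IsPrime] {N : ℕ}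
    (U : Fin N → A) (W : Fin N → ℕ) (hW : ∀ i, 0 < W i) (P : Ideal (Localization.AtPrime 𝔪))
    (hU : (Ideal.span {x | ∃ i, 0 < W i ∧ x = U i}).map (algebraMap A (Localization.AtPrime 𝔪)) = P)
    (C : PrimeSpectrum A → Prop)
    (hiff : ∃ h₁ : A, h₁ ∉ 𝔪 ∧ ∀ (𝔮 : Ideal A) [𝔮.IsPrime], h₁ ∉ 𝔮 →
      (P.comap (algebraMap A (Localization.AtPrime 𝔪)) ≤ 𝔮 ↔ C ⟨𝔮, ‹_›⟩)) :
    ∃ h : A, h ∉ 𝔪 ∧ ∀ (𝔮 : Ideal A) [𝔮.IsPrime], h ∉ 𝔮 → ((∀ i, U i ∈ 𝔮) ↔ C ⟨𝔮, ‹_›⟩) := by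
  obtain ⟨h, hh, hiff'⟩ := stratumIff_forall_mem_of_comap 𝔪 U W P hU C hiff
  exact ⟨h, hh, fun 𝔮 _ h𝔮 => by
    rw [← hiff' 𝔮 h𝔮]
    exact ⟨fun H i _ => H i, fun H i => H i (hW i)⟩⟩

/-! ## §2. Affine space over a perfect field: upper semicontinuity of the order in ideal form -/

section Affine

variable (K : Type) [Field K] [PerfectField K] {σ : Type} [Fintype σ] [DecidableEq σ]

/-- **u.s.c. of the order on affine space, ideal form** (`K` perfect; every prime `𝔮` of `K[x_σ]`):
`n ≤ ord_{A_𝔮} f ↔ (D^{(β)} f : |β| < n) ⊆ 𝔮` — the input `husc` of `stratumIff_iotaOrd_of_strat` with `h₀ = 1`.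
[cite: EGAIV4, Thm. 16.11.2] [cite: CossartPiltant2008, Prop. 4.2 (proof)] -/
theorem husc_iotaOrd_mvPolynomial (f : MvPolynomial σ K) (n : ℕ) :
    ∃ I : Ideal (MvPolynomial σ K), ∀ (𝔮 : Ideal (MvPolynomial σ K)) [𝔮.IsPrime], (1 : MvPolynomial σ K) ∉ 𝔮 →
      ((n : Ordinal) ≤ iotaOrd (Localization.AtPrime 𝔮) (algebraMap (MvPolynomial σ K) (Localization.AtPrime 𝔮) f) ↔
        I ≤ 𝔮) := by
  refine ⟨Ideal.span ((fun β : σ →₀ ℕ => hasseDeriv K β f) '' {β | Finsupp.degree β < n}), fun 𝔮 _ _ => ?_⟩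
  rw [natCast_le_iotaOrd_iff,
    algebraMap_mem_maximalIdeal_pow_iff_forall_hasseDeriv_mem K 𝔮 (Localization.AtPrime 𝔮) n f,
    Ideal.span_le, Set.image_subset_iff]
  rfl

/-- **STRATUM-EXACTNESS FOR THE ORDER FUNCTION ON AFFINE SPACE** (`K` perfect; any prime `𝔪` of `A = K[x_σ]`, closed or
not; `f/1 ≠ 0` in `A_𝔪`): the (strat)+(adm) conjuncts of `CanonicalGameClause` for `ι = iotaOrd` at `A_𝔪` with centre `P`
ALONE give `h ∉ 𝔪` with, for every prime `𝔮 ∌ h`: `P ∩ A ⊆ 𝔮 ↔ (f ∈ 𝔪_{A_𝔮}² ∧ ord_𝔮 f = ord_𝔪 f)` — the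
stratum-exactness iff of (open″) on this model, with no further input ((c7) and (c8) discharged:
`iotaOrd_localization_mono`, `husc_iotaOrd_mvPolynomial`; regular stalks: `K[x_σ]` is a regular ring).
[OURS · L1 W4.3, kernel] -/
theorem stratumIff_iotaOrd_mvPolynomial (𝔪 : Ideal (MvPolynomial σ K)) [𝔪.IsPrime] (f : MvPolynomial σ K)
    (hf0 : algebraMap (MvPolynomial σ K) (Localization.AtPrime 𝔪) f ≠ 0)
    (P : Ideal (Localization.AtPrime 𝔪)) [P.IsPrime]
    (hstrat : ∀ (𝔭 : Ideal (Localization.AtPrime 𝔪)) [𝔭.IsPrime],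
      algebraMap (MvPolynomial σ K) (Localization.AtPrime 𝔪) f ∈ 𝔭 →
        (iotaOrd (Localization.AtPrime 𝔭) (algebraMap (Localization.AtPrime 𝔪) (Localization.AtPrime 𝔭)
            (algebraMap (MvPolynomial σ K) (Localization.AtPrime 𝔪) f)) =
          iotaOrd (Localization.AtPrime 𝔪) (algebraMap (MvPolynomial σ K) (Localization.AtPrime 𝔪) f) ↔ P ≤ 𝔭))
    (hadm : ∀ (Q : Ideal (Localization.AtPrime 𝔪)) [Q.IsPrime], P ≤ Q →
      algebraMap (Localization.AtPrime 𝔪) (Localization.AtPrime Q)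
          (algebraMap (MvPolynomial σ K) (Localization.AtPrime 𝔪) f) ∈
        maximalIdeal (Localization.AtPrime Q) ^ 2) :
    ∃ h : MvPolynomial σ K, h ∉ 𝔪 ∧ ∀ (𝔮 : Ideal (MvPolynomial σ K)) [𝔮.IsPrime], h ∉ 𝔮 →
      (P.comap (algebraMap (MvPolynomial σ K) (Localization.AtPrime 𝔪)) ≤ 𝔮 ↔
        (algebraMap (MvPolynomial σ K) (Localization.AtPrime 𝔮) f ∈ maximalIdeal (Localization.AtPrime 𝔮) ^ 2 ∧
          iotaOrd (Localization.AtPrime 𝔮) (algebraMap (MvPolynomial σ K) (Localization.AtPrime 𝔮) f) =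
            iotaOrd (Localization.AtPrime 𝔪) (algebraMap (MvPolynomial σ K) (Localization.AtPrime 𝔪) f))) :=
  stratumIff_iotaOrd_of_strat 𝔪 f hf0 1 (fun h => Ideal.IsPrime.ne_top ‹_› ((Ideal.eq_top_iff_one 𝔪).mpr h))
    (fun 𝔮 _ _ => IsRegularRing.isRegularLocalRing_localization 𝔮)
    (fun n => husc_iotaOrd_mvPolynomial K f n) P hstrat hadm

end Affine

end StratumIff

end Summit.ResolutionOfSingularities.ResolutionOfSingularities.Cruxes.HypersurfaceCentreConstruction.LocalEngine

end
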